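import Summits.QuantumFields.YangMills.Theorems.BalabanUVNodesN09ContTransportOfLoopSmallSharp
import Summits.QuantumFields.YangMills.Theorems.BalabanUVNodesN09Chi29ThresholdsNowhereFibreFlat
import Literature.MathematicalPhysics.QuantumFieldTheory.Balaban1983to89.Node00.SmallFieldChi29OfRecord

/-!
# NODE N09 [B12] · ROAD B CLOSED BY NAME FOR DENSITIES CUT AT THE (2.9) THRESHOLDS: every bounded density on the loop α-guard that is continuous wherever no
# non-central (2.9) threshold is active has a REGULAR renormalisation transform (every open coarse set in `regSetOfRecord`, `HasContTransportOn`, `TcanOfRecord` continuous)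

Cell `pub-ymgap` (YM-PLAN Track A), DAG node N09 [Balaban1987RG1] (= [I]); width seat `pub-ymgap-dag-n09-w3` g5; count-neutral helper keyed to K1⁹
`StabilityBRunRowsAtRecordR13SepCoPHV` = stmt-QuantumFields-27364 (`--kind proof --supports … --as helper`).  The INSTANTIATION named by dag-n09-w2 g4's ■ trigger (t1′)
(INBOX l.≈37100): its junction `…N09ContTransportOfLoopSmallSharp.regular_of_loopSmall_sharp` (p630065) displays a threshold family `Γ`, windows `O₀`, fibrewise analyticity
`hΓan`, the «nowhere fibre-flat» clause `hnf` and the link `hQ`; THIS FILE fills them with the (2.9) DETERMINANT FAMILY of this seat's `…N09Chi29ThresholdsNowhereFibreFlat`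
(p631718) and leaves displayed only what belongs to the record: the β-input's continuity OFF the thresholds (N07) and its α-guard support.

WHY ∕ HOW.  Per fine configuration `U₀` of the support, in dag-n09-w4 g5's exponential chart: `ψ_{U₀}(A)(c) = Λ(Ū(Θ^B(A)·U₀)(c)·Ū(U₀)(c)⁻¹)`; the coarse field of a chart
point `y` is `V_y(c) = Θ(y c)·Ū(U₀)(c)`, and on the INVERSION WINDOW `{A | ∀ c, ‖↑(Ū(Θ^B(A)·U₀)(c)·Ū(U₀)(c)⁻¹) − 1‖ < r_C}` (a neighbourhood of `0`: `Ū` is continuous at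
`U₀` on the guard) one has `V_{ψ_{U₀}(A)} = Ū(Θ^B(A)·U₀)` (`Λ ∘ Θ`-inversion).  The family is `Γ U₀ b y A = normSq det((ε₁²−2)·1 + W + Wᴴ)`,
`W = ↑V^{(k)}(V_y)(b)⁻¹·↑Θ(A b)·↑U₀(b)` over the NON-central bonds `b`; on the inversion window `‖W − 1‖ = fluctDev_k(Θ^B(A)·U₀)(b)` (K0e's `fluctDevOfRecord_apply`), so
`Γ ≠ 0 ⇒ fluctDev ≠ ε₁` (p607548 `det_level_eq_zero_of_norm_sub_one_eq`) — the link `hQ` to the record-level exemption; `hΓan`, `hnf` and the windows are p631718's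
`analyticOnNhd_detFamily` ∕ `exists_nhds_nowhereFibreFlat_detFamily`.

WHAT IS PROVED (theorems only; 0 def, 0 sorry; axioms standard).
* `coarse_chartInverse_eq_avg` — on the inversion window, `(c ↦ Θ(ψ_{U₀}(A)(c))·Ū(U₀)(c)) = Ū(Θ^B(A)·U₀)`.
* `inversionWindow_mem_nhds_zero` — the inversion window is a neighbourhood of `0` (guard at `U₀`).
* ★★★ `regular_of_loopSmall_chi29` — for `k < K`, `ε₁ ≠ 0`, `ρ ≥ 0` measurable bounded, zero off a closed `K₀` inside the loop α-guard (standing range), and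
  `∀ U ∈ K₀, (∀ b, (∀ c, β(c) ≠ b) → fluctDev_k(U)(b) ≠ ε₁) → ContinuousAt ρ U`:
  `(∀ U open, U ⊆ regSetOfRecord F N K k ρ ∧ HasContTransportOn F N K k ρ U) ∧ Continuous (TcanOfRecord F N K k ρ)`.
* ★ `domAlt_subset_regSetOfRecord_of_loopSmall_chi29` — the `hreg` SHAPE `domAltOfRecord F N ν' K (k+1) ⊆ regSetOfRecord F N K k ρ`.

HONEST SCOPE ∕ FRAMING.  LOCATED, count-neutral junction BY NAME (one `exact` over p630065 with p631718's data; K0e's `fluctDevOfRecord_apply`; p607548; w4's `continuousAt_avgFun_of_small`;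
p28's `expChart_logChart`).  The record's β-input `ρ_k = χ^{(2.9)}_k·exp[…]` is NOT shown to satisfy the displayed exemption here (that is N07's continuity of the minimiser on the
domain + the `effActionHT` tower — other lanes); NOTHING of Bałaban's asserted; `hreg` at the record NOT discharged; N09 NOT discharged; conjunct 1 (Lemma 4) ∕ FLAG №7 untouched;
K0⁷ ∕ K1⁹ ∕ K3⁸ NOT closed; counts unmoved (typed 28∕28 · discharged 5∕28); one finite four-torus programme at fixed `ε = L^{−K}` per run — R4 closes the conditional rung
`BalabanLadder.UV` only; NOT ℝ⁴ ∕ infinite volume ∕ OS; the Yang–Mills mass gap (Clay) is NOT proved by any of this.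
-/

noncomputable section

open scoped Matrix.Norms.L2Operator Topology ENNReal
open Filter Set Function MeasureTheory

namespace Summit.QuantumFields.YangMills.BalabanUVNodes.N09RegularOfLoopSmallChi29

open Literature.MathematicalPhysics.QuantumFieldTheory.Balaban1983to89
open Literature.MathematicalPhysics.QuantumFieldTheory.Balaban1983to89.HaarExponentialChart
open Literature.MathematicalPhysics.QuantumFieldTheory.Balaban1983to89.HaarExponentialChart.IsChartRep
open Literature.MathematicalPhysics.QuantumFieldTheory.Balaban1983to89.BlockAveraging (Small Idx avgFun loopHol)
open Literature.MathematicalPhysics.QuantumFieldTheory.Balaban1983to89.BlockAveragingHaarAC (centralBond)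
open Literature.MathematicalPhysics.QuantumFieldTheory.Balaban1983to89.ExpMeanLog (expMeanLogSU deltaSU)
open Literature.MathematicalPhysics.QuantumFieldTheory.Balaban1983to89.Node00
open Literature.MathematicalPhysics.QuantumLattice (fundamentalRep fundamentalRep_apply)
open Summit.QuantumFields.YangMills.BalabanUVNodes.N09ChartReadAveragingSmooth (continuousAt_avgFun_of_small)
open Summit.QuantumFields.YangMills.BalabanUVNodes.N09ContTransportOfLoopSmallSharp (regular_of_loopSmall_sharp)
open Summit.QuantumFields.YangMills.BalabanUVNodes.N09Chi29ThresholdsNowhereFibreFlat (analyticOnNhd_detFamily exists_nhds_nowhereFibreFlat_detFamily)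

variable {F : T4Continuum.T4Family} {N : ℕ} [NeZero N] {K k : ℕ}

/-! ## §1 The inversion window: the coarse field of the chart point `ψ_{U₀}(A)` IS `Ū(Θ^B(A)·U₀)` -/

/-- **On the inversion window the coarse chart inverse recovers the average**: if `‖↑(Ū(Θ^B(A)·U₀)(c)·Ū(U₀)(c)⁻¹) − 1‖ < r_C` for every coarse bond `c`, then
`Θ(ψ_{U₀}(A)(c))·Ū(U₀)(c) = Ū(Θ^B(A)·U₀)(c)` (`Θ ∘ Λ = id` on the log window, p28's `expChart_logChart`). [cite: Helgason2000, Ch. I §1 Thm. 1.14 (13) p. 96; Balaban1987RG1, (2.10) p.267] -/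
theorem coarse_chartInverse_eq_avg (U₀ : GaugeField (F.P K) k (SU N)) (A : PBond (F.P K) k → (specialUnitaryLogChart (Fin N)).lie)
    (hwin : ∀ c, ‖(((avOfRecord F N K k).avg (fun b => (isChartRep_specialUnitaryGroup (n := Fin N)).expChart (A b) * U₀ b) c *
      ((avOfRecord F N K k).avg U₀ c)⁻¹ : SU N) : Matrix (Fin N) (Fin N) ℂ) - 1‖ < innerRadius (specialUnitaryLogChart (Fin N))) :
    (fun c => (isChartRep_specialUnitaryGroup (n := Fin N)).expChart
        ((isChartRep_specialUnitaryGroup (n := Fin N)).logChart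
          ((avOfRecord F N K k).avg (fun b => (isChartRep_specialUnitaryGroup (n := Fin N)).expChart (A b) * U₀ b) c *
            ((avOfRecord F N K k).avg U₀ c)⁻¹)) * (avOfRecord F N K k).avg U₀ c) =
      (avOfRecord F N K k).avg (fun b => (isChartRep_specialUnitaryGroup (n := Fin N)).expChart (A b) * U₀ b) := by
  funext c
  have h := (isChartRep_specialUnitaryGroup (n := Fin N)).expChart_logChart
    (g := (avOfRecord F N K k).avg (fun b => (isChartRep_specialUnitaryGroup (n := Fin N)).expChart (A b) * U₀ b) c *
      ((avOfRecord F N K k).avg U₀ c)⁻¹) (by rw [fundamentalRep_apply]; exact hwin c)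
  rw [h, inv_mul_cancel_right]

/-- **The inversion window is a neighbourhood of `0`** when `U₀` is in the guard (the (0.4) averaging is continuous at `U₀`, dag-n09-w4 g5's `continuousAt_avgFun_of_small`; at
`A = 0` the ratio is `1`). [cite: Balaban1987RG1, (0.4) p.253 and (2.10) p.267] -/
theorem inversionWindow_mem_nhds_zero (U₀ : GaugeField (F.P K) k (SU N)) (hsmall : ∀ c, Small (expMeanLogSU (n := Fin N)) U₀ c) :
    {A : PBond (F.P K) k → (specialUnitaryLogChart (Fin N)).lie | ∀ c,
      ‖(((avOfRecord F N K k).avg (fun b => (isChartRep_specialUnitaryGroup (n := Fin N)).expChart (A b) * U₀ b) c *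
        ((avOfRecord F N K k).avg U₀ c)⁻¹ : SU N) : Matrix (Fin N) (Fin N) ℂ) - 1‖ < innerRadius (specialUnitaryLogChart (Fin N))} ∈
      𝓝 (0 : PBond (F.P K) k → (specialUnitaryLogChart (Fin N)).lie) := by
  -- `A ↦ Θ^B(A)·U₀` is continuous with value `U₀` at `0`; `Ū` is continuous at `U₀`
  have hΘ : Continuous fun (A : PBond (F.P K) k → (specialUnitaryLogChart (Fin N)).lie) (b : PBond (F.P K) k) =>
      (isChartRep_specialUnitaryGroup (n := Fin N)).expChart (A b) * U₀ b :=
    continuous_pi fun b => ((isChartRep_specialUnitaryGroup (n := Fin N)).continuous_expChart.comp (continuous_apply b)).mul continuous_const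
  have hΘ0 : (fun (b : PBond (F.P K) k) => (isChartRep_specialUnitaryGroup (n := Fin N)).expChart ((0 : PBond (F.P K) k →
      (specialUnitaryLogChart (Fin N)).lie) b) * U₀ b) = U₀ := by
    funext b; rw [Pi.zero_apply, (isChartRep_specialUnitaryGroup (n := Fin N)).expChart_zero, one_mul]
  have havg : ContinuousAt (fun A : PBond (F.P K) k → (specialUnitaryLogChart (Fin N)).lie =>
      (avOfRecord F N K k).avg (fun b => (isChartRep_specialUnitaryGroup (n := Fin N)).expChart (A b) * U₀ b)) 0 := by
    have h1 : ContinuousAt ((avOfRecord F N K k).avg) U₀ := continuousAt_avgFun_of_small (P := F.P K) (j := k) U₀ hsmall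
    have h2 : ContinuousAt (fun (A : PBond (F.P K) k → (specialUnitaryLogChart (Fin N)).lie) (b : PBond (F.P K) k) =>
        (isChartRep_specialUnitaryGroup (n := Fin N)).expChart (A b) * U₀ b) 0 := hΘ.continuousAt
    rw [← hΘ0] at h1
    exact ContinuousAt.comp (g := (avOfRecord F N K k).avg) h1 h2
  -- each ratio is continuous at `0` with value `1`
  have hset : {A : PBond (F.P K) k → (specialUnitaryLogChart (Fin N)).lie | ∀ c,
      ‖(((avOfRecord F N K k).avg (fun b => (isChartRep_specialUnitaryGroup (n := Fin N)).expChart (A b) * U₀ b) c *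
        ((avOfRecord F N K k).avg U₀ c)⁻¹ : SU N) : Matrix (Fin N) (Fin N) ℂ) - 1‖ < innerRadius (specialUnitaryLogChart (Fin N))} =
      ⋂ c, {A | ‖(((avOfRecord F N K k).avg (fun b => (isChartRep_specialUnitaryGroup (n := Fin N)).expChart (A b) * U₀ b) c *
        ((avOfRecord F N K k).avg U₀ c)⁻¹ : SU N) : Matrix (Fin N) (Fin N) ℂ) - 1‖ < innerRadius (specialUnitaryLogChart (Fin N))} := by
    ext A; simp only [mem_setOf_eq, mem_iInter]
  rw [hset, Filter.iInter_mem]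
  intro c
  have hc : ContinuousAt (fun A : PBond (F.P K) k → (specialUnitaryLogChart (Fin N)).lie =>
      ‖(((avOfRecord F N K k).avg (fun b => (isChartRep_specialUnitaryGroup (n := Fin N)).expChart (A b) * U₀ b) c *
        ((avOfRecord F N K k).avg U₀ c)⁻¹ : SU N) : Matrix (Fin N) (Fin N) ℂ) - 1‖) 0 := by
    have h1 : ContinuousAt (fun A : PBond (F.P K) k → (specialUnitaryLogChart (Fin N)).lie =>
        (avOfRecord F N K k).avg (fun b => (isChartRep_specialUnitaryGroup (n := Fin N)).expChart (A b) * U₀ b) c *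
          ((avOfRecord F N K k).avg U₀ c)⁻¹) 0 := ((continuous_apply c).continuousAt.comp havg).mul continuousAt_const
    exact ((continuous_subtype_val.continuousAt.comp h1).sub continuousAt_const).norm
  have h0 : ‖(((avOfRecord F N K k).avg (fun b => (isChartRep_specialUnitaryGroup (n := Fin N)).expChart
      ((0 : PBond (F.P K) k → (specialUnitaryLogChart (Fin N)).lie) b) * U₀ b) c * ((avOfRecord F N K k).avg U₀ c)⁻¹ : SU N) :
        Matrix (Fin N) (Fin N) ℂ) - 1‖ < innerRadius (specialUnitaryLogChart (Fin N)) := by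
    rw [hΘ0, mul_inv_cancel]
    simp only [OneMemClass.coe_one, sub_self, norm_zero]
    exact innerRadius_pos
  exact hc.preimage_mem_nhds (isOpen_Iio.mem_nhds h0)

/-! ## §2 The junction instantiated with the determinant family -/

/-- ★★★ **ROAD B CLOSED BY NAME FOR DENSITIES CUT AT THE (2.9) THRESHOLDS.**  For `k < K`, `ε₁ ≠ 0`, the loop α-guard in the standing range (`α ≤ 1∕24`, `α < δ_N`,
`157·α < L^{1−d}`), `ν : Stage7Numerics` (the critical configuration `V^{(k)} = critCfgOfRecord ν K k`, ARBITRARY — no regularity used), and every measurable `ρ ≥ 0`, bounded,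
zero off a closed `K₀` inside the guard and CONTINUOUS AT EVERY `U ∈ K₀` AT WHICH NO NON-CENTRAL (2.9) THRESHOLD IS ACTIVE (`∀ b, (∀ c, β(c) ≠ b) → fluctDev_k(U)(b) ≠ ε₁`):
every open set of coarse fields lies in `regSetOfRecord F N K k ρ` with `HasContTransportOn`, and `TcanOfRecord F N K k ρ` is continuous — dag-n09-w2's `regular_of_loopSmall_sharp`
with the determinant family of `…N09Chi29ThresholdsNowhereFibreFlat` (fibrewise analytic, nowhere fibre-flat: NO transversality), the windows cut by the inversion window of §1,
and the link «`Γ ≠ 0` ⇒ threshold inactive» by p607548.  The displayed exemption is N07's content (continuity of the minimiser at the β-input), NOT claimed.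
[cite: Balaban1987RG1, (0.13) p.254, p.259, (2.9) p.266 and (2.10) p.267] [cite: Mityagin2015, Proposition 1] [cite: Balaban1985Averaging, (19) p.21] -/
theorem regular_of_loopSmall_chi29 (ν : Stage7Numerics) (hk : k < K) {α : ℝ} (hα24 : α ≤ 1 / 24) (hαδ : α < deltaSU (Fin N))
    (hαL : 157 * α < (((F.P K).L : ℝ) ^ ((F.P K).d - 1))⁻¹) {ε₁ : ℝ} (hε : ε₁ ≠ 0) {ρ : Density (F.P K) k (SU N)}
    (hρm : Measurable ρ) (hρ0 : ∀ U, 0 ≤ ρ U) (hρC : ∃ C₀ : ℝ, ∀ U, ρ U ≤ C₀)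
    {K₀ : Set (GaugeField (F.P K) k (SU N))} (hK₀ : IsClosed K₀) (hρK : ∀ U, U ∉ K₀ → ρ U = 0)
    (hK₀α : ∀ U ∈ K₀, ∀ c i, dist1 (loopHol U c i) ≤ α)
    (hρc : ∀ U ∈ K₀, (∀ b : PBond (F.P K) k, (∀ c, centralBond c ≠ b) → fluctDevOfRecord F N ν K k U b ≠ ε₁) → ContinuousAt ρ U) :
    (∀ U : Set (PBond (F.P K) (k + 1) → SU N), IsOpen U → U ⊆ regSetOfRecord F N K k ρ ∧ HasContTransportOn F N K k ρ U) ∧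
      Continuous (TcanOfRecord F N K k ρ) := by
  classical
  have hj : k + 1 ≤ (F.P K).m + (F.P K).K := by simp only [T4Continuum.T4Family.P_K]; omega
  -- the letters: Θ, Λ, the critical letter through the coarse chart inverse, the determinant family
  set Θ := (isChartRep_specialUnitaryGroup (n := Fin N)).expChart with hΘdef
  set Λ := (isChartRep_specialUnitaryGroup (n := Fin N)).logChart with hΛdef
  set hcrit : GaugeField (F.P K) k (SU N) → PBond (F.P K) k → (PBond (F.P K) (k + 1) → (specialUnitaryLogChart (Fin N)).lie) → SU N :=
    fun U₀ b y => (critCfgOfRecord F N ν K k (fun c => Θ (y c) * (avOfRecord F N K k).avg U₀ c) b)⁻¹ with hhcrit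
  set Γ : GaugeField (F.P K) k (SU N) → {b : PBond (F.P K) k // ∀ c, centralBond c ≠ b} →
      (PBond (F.P K) (k + 1) → (specialUnitaryLogChart (Fin N)).lie) → (PBond (F.P K) k → (specialUnitaryLogChart (Fin N)).lie) → ℝ :=
    fun U₀ i y A => Complex.normSq ((((ε₁ ^ 2 - 2 : ℝ) : ℂ)) • (1 : Matrix (Fin N) (Fin N) ℂ) +
      ((hcrit U₀ i.1 y : Matrix (Fin N) (Fin N) ℂ) * (Θ (A i.1) : Matrix (Fin N) (Fin N) ℂ) * (U₀ i.1 : Matrix (Fin N) (Fin N) ℂ)) +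
      ((hcrit U₀ i.1 y : Matrix (Fin N) (Fin N) ℂ) * (Θ (A i.1) : Matrix (Fin N) (Fin N) ℂ) * (U₀ i.1 : Matrix (Fin N) (Fin N) ℂ)).conjTranspose).det with hΓdef
  -- per `U₀ ∈ K₀`: the window of p631718 (hnf) and the inversion window of §1
  have hsmall : ∀ U₀ ∈ K₀, ∀ c, Small (expMeanLogSU (n := Fin N)) U₀ c := fun U₀ hU₀ c i => lt_of_le_of_lt (hK₀α U₀ hU₀ c i) hαδ
  have hW5 : ∀ U₀ ∈ K₀, ∃ O₁ : Set (PBond (F.P K) k → (specialUnitaryLogChart (Fin N)).lie), IsOpen O₁ ∧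
      (0 : PBond (F.P K) k → (specialUnitaryLogChart (Fin N)).lie) ∈ O₁ ∧
      (∀ A ∈ O₁, ∀ b, ‖A b‖ < chartRadius (specialUnitaryLogChart (Fin N))) ∧
      ∀ A ∈ O₁, ∀ i, Γ U₀ i ((fun A : PBond (F.P K) k → (specialUnitaryLogChart (Fin N)).lie =>
          (fun (V : PBond (F.P K) (k + 1) → SU N) (c : PBond (F.P K) (k + 1)) => Λ (V c * ((avOfRecord F N K k).avg U₀ c)⁻¹))
            ((avOfRecord F N K k).avg (fun b => Θ (A b) * U₀ b))) A) A = 0 →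
        ∃ᶠ A' in 𝓝[(fun A : PBond (F.P K) k → (specialUnitaryLogChart (Fin N)).lie =>
            (fun (V : PBond (F.P K) (k + 1) → SU N) (c : PBond (F.P K) (k + 1)) => Λ (V c * ((avOfRecord F N K k).avg U₀ c)⁻¹))
              ((avOfRecord F N K k).avg (fun b => Θ (A b) * U₀ b))) ⁻¹'
            {(fun A : PBond (F.P K) k → (specialUnitaryLogChart (Fin N)).lie =>
              (fun (V : PBond (F.P K) (k + 1) → SU N) (c : PBond (F.P K) (k + 1)) => Λ (V c * ((avOfRecord F N K k).avg U₀ c)⁻¹))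
                ((avOfRecord F N K k).avg (fun b => Θ (A b) * U₀ b))) A}] A,
          Γ U₀ i ((fun A : PBond (F.P K) k → (specialUnitaryLogChart (Fin N)).lie =>
            (fun (V : PBond (F.P K) (k + 1) → SU N) (c : PBond (F.P K) (k + 1)) => Λ (V c * ((avOfRecord F N K k).avg U₀ c)⁻¹))
              ((avOfRecord F N K k).avg (fun b => Θ (A b) * U₀ b))) A) A' ≠ 0 :=
    fun U₀ hU₀ => exists_nhds_nowhereFibreFlat_detFamily (P := F.P K) (j := k) U₀ (hcrit U₀) ε₁ hj (hK₀α U₀ hU₀) hα24 hαδ hαL hε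
      rfl (fun _ _ _ => rfl)
  choose! O₁ hO₁o h0O₁ hO₁box hO₁nf using hW5
  -- the inversion windows
  set Winv : GaugeField (F.P K) k (SU N) → Set (PBond (F.P K) k → (specialUnitaryLogChart (Fin N)).lie) := fun U₀ =>
    interior {A | ∀ c, ‖(((avOfRecord F N K k).avg (fun b => Θ (A b) * U₀ b) c * ((avOfRecord F N K k).avg U₀ c)⁻¹ : SU N) :
      Matrix (Fin N) (Fin N) ℂ) - 1‖ < innerRadius (specialUnitaryLogChart (Fin N))} with hWinv
  refine regular_of_loopSmall_sharp hk hα24 hαδ hαL hρm hρ0 hρC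
    (fun U => ∀ b : PBond (F.P K) k, (∀ c, centralBond c ≠ b) → fluctDevOfRecord F N ν K k U b ≠ ε₁) hK₀ hρK hρc hK₀α
    Γ (fun U₀ => O₁ U₀ ∩ Winv U₀) (fun U₀ hU₀ => (hO₁o U₀ hU₀).inter isOpen_interior)
    (fun U₀ hU₀ => ⟨h0O₁ U₀ hU₀, mem_interior_iff_mem_nhds.2 (inversionWindow_mem_nhds_zero U₀ (hsmall U₀ hU₀))⟩)
    (fun U₀ hU₀ i y => (analyticOnNhd_detFamily (P := F.P K) (j := k) U₀ (hcrit U₀) ε₁ i.1 y).mono (subset_univ _))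
    (fun U₀ hU₀ A hA i => hO₁nf U₀ hU₀ A hA.1 i) ?_
  -- `hQ`: off the zero sets of the determinant family no non-central threshold is active at `Θ^B(A)·U₀`
  intro U₀ hU₀ A hA hne b hb hdev
  have hwin := interior_subset hA.2
  have hV : (fun c => Θ (Λ ((avOfRecord F N K k).avg (fun b => Θ (A b) * U₀ b) c * ((avOfRecord F N K k).avg U₀ c)⁻¹)) *
      (avOfRecord F N K k).avg U₀ c) = (avOfRecord F N K k).avg (fun b => Θ (A b) * U₀ b) :=
    coarse_chartInverse_eq_avg U₀ A hwin
  -- the unitary letter of the threshold at `b`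
  have hW : fluctDevOfRecord F N ν K k (fun b => Θ (A b) * U₀ b) b =
      ‖(hcrit U₀ b ((fun A : PBond (F.P K) k → (specialUnitaryLogChart (Fin N)).lie =>
          (fun (V : PBond (F.P K) (k + 1) → SU N) (c : PBond (F.P K) (k + 1)) => Λ (V c * ((avOfRecord F N K k).avg U₀ c)⁻¹))
            ((avOfRecord F N K k).avg (fun b => Θ (A b) * U₀ b))) A) : Matrix (Fin N) (Fin N) ℂ) *
        (Θ (A b) : Matrix (Fin N) (Fin N) ℂ) * (U₀ b : Matrix (Fin N) (Fin N) ℂ) - 1‖ := by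
    rw [fluctDevOfRecord_apply]
    show ‖(((critCfgOfRecord F N ν K k ((avOfRecord F N K k).avg (fun b => Θ (A b) * U₀ b)) b)⁻¹ * (Θ (A b) * U₀ b) : SU N) :
        Matrix (Fin N) (Fin N) ℂ) - 1‖ = _
    rw [Submonoid.coe_mul, Submonoid.coe_mul, ← mul_assoc]
    simp only [hhcrit, hV]
  have hΓ0 : Γ U₀ ⟨b, hb⟩ ((fun A : PBond (F.P K) k → (specialUnitaryLogChart (Fin N)).lie =>
      (fun (V : PBond (F.P K) (k + 1) → SU N) (c : PBond (F.P K) (k + 1)) => Λ (V c * ((avOfRecord F N K k).avg U₀ c)⁻¹))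
        ((avOfRecord F N K k).avg (fun b => Θ (A b) * U₀ b))) A) A = 0 := by
    have hunit : (hcrit U₀ b ((fun A : PBond (F.P K) k → (specialUnitaryLogChart (Fin N)).lie =>
        (fun (V : PBond (F.P K) (k + 1) → SU N) (c : PBond (F.P K) (k + 1)) => Λ (V c * ((avOfRecord F N K k).avg U₀ c)⁻¹))
          ((avOfRecord F N K k).avg (fun b => Θ (A b) * U₀ b))) A) : Matrix (Fin N) (Fin N) ℂ) *
        (Θ (A b) : Matrix (Fin N) (Fin N) ℂ) * (U₀ b : Matrix (Fin N) (Fin N) ℂ) ∈ Matrix.unitaryGroup (Fin N) ℂ := by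
      rw [← Submonoid.coe_mul, ← Submonoid.coe_mul]
      exact (Matrix.mem_specialUnitaryGroup_iff.mp (SetLike.coe_mem _)).1
    have hdet := HaarDist1LevelHypersurface.det_level_eq_zero_of_norm_sub_one_eq hunit (hW.symm.trans hdev)
    show Complex.normSq _ = 0
    rw [Complex.normSq_eq_zero]
    exact hdet
  exact hne ⟨b, hb⟩ hΓ0

/-- ★ **THE `hreg` SHAPE FOR (2.9)-THRESHOLD-CUT DENSITIES ON THE GUARD**: `domAltOfRecord F N ν' K (k+1) ⊆ regSetOfRecord F N K k ρ` — the binder of the N09 small-field-bookkeeping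
doors — for every `ρ` as in `regular_of_loopSmall_chi29` (the second-form domain is open, `isOpen_domAltOfRecord`). [cite: Balaban1987RG1, p.259 and (2.9) p.266] -/
theorem domAlt_subset_regSetOfRecord_of_loopSmall_chi29 (ν ν' : Stage7Numerics) (hk : k < K) {α : ℝ} (hα24 : α ≤ 1 / 24) (hαδ : α < deltaSU (Fin N))
    (hαL : 157 * α < (((F.P K).L : ℝ) ^ ((F.P K).d - 1))⁻¹) {ε₁ : ℝ} (hε : ε₁ ≠ 0) {ρ : Density (F.P K) k (SU N)}
    (hρm : Measurable ρ) (hρ0 : ∀ U, 0 ≤ ρ U) (hρC : ∃ C₀ : ℝ, ∀ U, ρ U ≤ C₀)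
    {K₀ : Set (GaugeField (F.P K) k (SU N))} (hK₀ : IsClosed K₀) (hρK : ∀ U, U ∉ K₀ → ρ U = 0)
    (hK₀α : ∀ U ∈ K₀, ∀ c i, dist1 (loopHol U c i) ≤ α)
    (hρc : ∀ U ∈ K₀, (∀ b : PBond (F.P K) k, (∀ c, centralBond c ≠ b) → fluctDevOfRecord F N ν K k U b ≠ ε₁) → ContinuousAt ρ U) :
    domAltOfRecord F N ν' K (k + 1) ⊆ regSetOfRecord F N K k ρ :=
  ((regular_of_loopSmall_chi29 ν hk hα24 hαδ hαL hε hρm hρ0 hρC hK₀ hρK hK₀α hρc).1 _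
    (B12ContinuousTransportInvarianceOn.isOpen_domAltOfRecord ν' K (k + 1))).1

end Summit.QuantumFields.YangMills.BalabanUVNodes.N09RegularOfLoopSmallChi29

end
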